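import Mathlib.MeasureTheory.Measure.Count
import Summits.ABC.IUTFork.LanaRssBridge
import HarnessLib

/-!
# L-LANA objects V quater: vacuity checks for (9-1) over a REAL measure — (8-1) does not force (9-1)

Record-only file (D-0012) of the abc-iut cell (seat abc-iut-c312-4, L-LANA level; the measure-level
counterpart of skel VIII's finite witness `OutputRegions.cor312_not_imp_represented` and of the cell's rule
"vacuity-audit every fork-level hypothesis with a non-vacuity witness"); TAKES NO SIDE on [IUTchIII]
Cor. 3.12. Over the two-point space `Bool` with Mathlib's COUNTING measure (so `{true}` has volume `1`,
`univ` volume `2`), two `η`-data of `LanaRss`: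

* `strictModel` — `q`-region `{true}`, the only suitable output region `LGP·S = univ` = the hull: then
  (8-1) `−|log(q)| ≤ −|log(Θ)|` HOLDS (`0 ≤ log 2`) while LANA's (9-1) FAILS (`log 2 ≠ 0`) — `strictModel_cor312`,
  `strictModel_not_mainGoal`, hence `cor312_not_imp_mainGoal`: at measure level too, the inequality of
  Cor. 3.12 is strictly weaker than (9-1) (LANA §10.3 p. 48 "(9-1) asserts a comparison of two constructions
  before computing degrees").
* `exactModel` — the only suitable output region IS the `q`-region: (9-1) HOLDS (`exactModel_mainGoal`), so
  (9-1) is satisfiable on real data; together the two show `EtaData.MainGoal` is a genuine, non-vacuous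
  hypothesis (neither automatic nor impossible), as LANA say: "not manifestly false … we do not have a proof"
  (§10.5 p. 49).

[cite: LANA2026Report, §9.2 (9-1) p. 46, §10.3 p. 48, §10.5 p. 49] NOT here: any judgement.
-/

noncomputable section

open MeasureTheory

namespace Summit.ABC
namespace IUTFork
namespace RssChecks

/-- The counting measure on the two-point space (volumes `1` and `2`). [folklore] -/
abbrev μ₂ : Measure Bool := Measure.count

/-- The region `{true}` (volume `1`). [folklore] -/
def ptRegion : Region μ₂ where
  carrier := {true}
  measurable := trivial
  vol_ne_zero := by
    rw [Measure.count_singleton]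
    exact one_ne_zero
  vol_ne_top := by
    rw [Measure.count_singleton]
    exact ENNReal.one_ne_top

/-- The region `univ` (volume `2`). [folklore] -/
def allRegion : Region μ₂ where
  carrier := Set.univ
  measurable := trivial
  vol_ne_zero := by
    rw [Measure.count_apply_finite _ Set.finite_univ]
    simp
  vol_ne_top := by
    rw [Measure.count_apply_finite _ Set.finite_univ]
    exact ENNReal.coe_ne_top

/-- `log-vol({true}) = 0`. [folklore] -/
theorem ptRegion_logVol : ptRegion.logVol = 0 := by
  rw [Region.logVol, show μ₂ ptRegion.carrier = 1 from Measure.count_singleton _]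
  simp

/-- `log-vol(univ) = log 2 > 0`. [folklore] -/
theorem allRegion_logVol : allRegion.logVol = Real.log 2 := by
  rw [Region.logVol, show allRegion.carrier = (Set.univ : Set Bool) from rfl,
    Measure.count_apply_finite _ Set.finite_univ]
  simp

/-- A pointed line to serve as `ℝ^val` (the BPS side plays no role in these checks).
[cite: LANA2026Report, §9.2 p. 46] -/
def someRval : PointedLine := volLine 1 one_ne_zero

/-- **The strict model**: `q`-region `{true}`; one suitable `S`, with `LGP·S = univ`; hull `= univ`.
[cite: LANA2026Report, §9.2 p. 46] -/
def strictModel : EtaData μ₂ where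
  Rval := someRval
  qRegion := ptRegion
  LGP _ := allRegion
  Suitable := {allRegion}
  hull := allRegion

/-- Its suitable regions lie in the hull. [folklore] -/
theorem strictModel_suitableInHull : strictModel.SuitableInHull := fun _ _ => subset_rfl

/-- **(8-1) holds in the strict model**: `0 ≤ log 2`. [cite: LANA2026Report, §8.1 (8-1) p. 41] -/
theorem strictModel_cor312 : strictModel.negAbsLogq ≤ strictModel.negAbsLogTheta := by
  change ptRegion.logVol ≤ allRegion.logVol
  rw [ptRegion_logVol, allRegion_logVol]
  exact Real.log_nonneg (by norm_num)

/-- **(9-1) fails in the strict model**: the only possible value `log 2` is not `−|log(q)| = 0`.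
[cite: LANA2026Report, §9.2 (9-1) p. 46] -/
theorem strictModel_not_mainGoal : ¬ strictModel.MainGoal := by
  rw [EtaData.mainGoal_iff_logVol]
  rintro ⟨S, -, hvol⟩
  change allRegion.logVol = ptRegion.logVol at hvol
  rw [allRegion_logVol, ptRegion_logVol] at hvol
  exact absurd hvol (Real.log_pos (by norm_num)).ne'

/-- **(8-1) does not force (9-1)**, on real measure-theoretic data (the measure-level counterpart of skel
VIII `cor312_not_imp_represented`). [cite: LANA2026Report, §10.3 p. 48] -/
theorem cor312_not_imp_mainGoal :
    ∃ E : EtaData μ₂, E.SuitableInHull ∧ E.negAbsLogq ≤ E.negAbsLogTheta ∧ ¬ E.MainGoal :=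
  ⟨strictModel, strictModel_suitableInHull, strictModel_cor312, strictModel_not_mainGoal⟩

/-- **The exact model**: the only suitable output region IS the `q`-region (hull `= univ`).
[cite: LANA2026Report, §9.2 p. 46] -/
def exactModel : EtaData μ₂ where
  Rval := someRval
  qRegion := ptRegion
  LGP S := S
  Suitable := {ptRegion}
  hull := allRegion

/-- **(9-1) holds in the exact model** — (9-1) is satisfiable on real data.
[cite: LANA2026Report, §9.2 (9-1) p. 46] -/
theorem exactModel_mainGoal : exactModel.MainGoal := ⟨ptRegion, rfl, rfl⟩

/-- Its suitable regions lie in the hull, and (8-1) follows from (9-1) there (`EtaData.cor312_of_mainGoal`).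
[cite: LANA2026Report, §9 p. 44] -/
theorem exactModel_cor312 : exactModel.negAbsLogq ≤ exactModel.negAbsLogTheta :=
  exactModel.cor312_of_mainGoal (fun _ _ => Set.subset_univ _) exactModel_mainGoal

end RssChecks
end IUTFork
end Summit.ABC

end
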